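import Summits.QuantumAdvantage.QuantumAdvantage.Theorems.CubicForrelationNearExactIsExactZeroModSixSecondTypeO
import Summits.QuantumAdvantage.QuantumAdvantage.Theorems.CubicForrelationNearExactIsExactSixteenSplitPrep
import Summits.QuantumAdvantage.QuantumAdvantage.Theorems.NearExactIsExact.Negative.NoCaseATwelve

/-!
# Crux `CubicForrelation.NearExactIsExact` (stmt-QuantumAdvantage-14043) — n = 12, TWO-SIDED: a type-O cubic never reaches `Φ = 15/16`

Certificate seat `b2b-cforr-cert` (gen 8).  HONEST FRAMING: a theorem about cubic Boolean pairs on 12 bits (finite slice `n = 12` of the crux) —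
the type-O configuration at the boundary value `15/16` of the certified bound `θ₁₂ ≤ 15/16` (`isolation_twelve_15_16`) is excluded
two-sidedly; NOT summit progress.

This is the `r = 2` case of the general-`r` file `…ZeroModSixSecondTypeO.lean`, where the proof needed `r ≥ 3` (`2^r ≡ 0 (mod 8)`).  At
`r = 2` the shift `4s ≡ 4 (mod 8)` swaps the roles of the digit classes: with `W_g = 16u`, `u` odd, `s = (−1)^f`, `τ = u − 4s ≡ u + 4 (mod 8)`,
the CHEAP points (`τ = ±1`) are those with `d₁ ≠ d₂` (`u ≡ ±3 (mod 8)`) and the expensive ones (`τ² ≥ 9`) those with `d₁ = d₂`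
(`tw12_pt`).  The all-cheap configuration `u ≡ ±3 (mod 8)` everywhere is exactly the tree's CASE A, excluded by `TypeOTwelve.no_caseA`
(`Negative/NoCaseATwelve.lean`, tiling parity).  Hence with the budget `Σ τ² = 2¹⁷(1−Φ) ≤ 2¹³` (`Φ ≥ 15/16`): `E = {d₁ = d₂}` is a non-empty
support of degree `≤ 3`, `#E ≥ 512`, the budget is spent exactly, `E` is a 9-flat, `τ = (−1)^{d₁}(1 − 4·1_E)` with `d₁` AFFINE
(`z2_digitOne`), so `Σ|τ̂| ≤ 2¹² + 4·2¹²` (`fp_l1_sq_mul_le`), while the pairing needs `Σ (−1)^g τ̂ = 2²⁰(1−Φ) = 2¹⁶`.  `tw12_typeO_false`.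

References: J. Ax (1964) / R. J. McEliece (1972); MacWilliams–Sloane (1977) Ch. 13–15; R. O'Donnell (2014) §3.3.  Everything below is proved
from Mathlib and the tree; axioms are the standard three.
-/

set_option linter.dupNamespace false -- D-0017: single-problem summit ⇒ `QuantumAdvantage.QuantumAdvantage` by design

noncomputable section

namespace Summit.QuantumAdvantage.QuantumAdvantage.Theorems.CubicForrelation.NearExactIsExact

open Finset
open Literature.Computability.QuantumComplexity
open Literature.Computability.QuantumComplexity.BuzetChailloux (bxor zeroVec bxor_bxor_cancel_left bxor_zeroVec zeroVec_bxor bxor_comm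
  bxor_self)
open Literature.Computability.QuantumComplexity.DerivativeWalsh (W)
open Summit.QuantumAdvantage.QuantumAdvantage.Theorems.NearExactIsExact.Negative (TypeOTwelve.no_caseA)

/-- **The two-sided pointwise inequality at 12 bits (type O).** For odd `v` and `s = ±1`: `1 + 8·[d₁ = d₂] ≤ (v − 4s)²`
(`v − 4s ≡ v + 4 (mod 8)`; `d₁ = d₂ ⟺ v ≡ ±1 (mod 8) ⟺ v − 4s ≡ ±3 (mod 8)`). [this work] -/
theorem tw12_pt (v s : ℤ) (hv : Odd v) (hs : s = 1 ∨ s = -1) :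
    1 + 8 * (if (Odd (v / 2) ↔ Odd (v / 2 / 2)) then 1 else 0 : ℤ) ≤ (v - 4 * s) ^ 2 := by
  rcases le_or_gt 12 |v| with h12 | h12
  · have hbig : (64 : ℤ) ≤ (v - 4 * s) ^ 2 := by
      have h8 : v - 4 * s ≤ -8 ∨ 8 ≤ v - 4 * s := by
        rcases hs with rfl | rfl
        · rcases le_or_gt 0 v with hv0 | hv0
          · rw [abs_of_nonneg hv0] at h12; omega
          · rw [abs_of_neg hv0] at h12; omega
        · rcases le_or_gt 0 v with hv0 | hv0
          · rw [abs_of_nonneg hv0] at h12; omega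
          · rw [abs_of_neg hv0] at h12; omega
      exact tp_sq_ge (k := 8) (by norm_num) h8
    have hconst : 1 + 8 * (if (Odd (v / 2) ↔ Odd (v / 2 / 2)) then 1 else 0 : ℤ) ≤ 9 := by split_ifs <;> norm_num
    linarith
  · have h1 : -11 ≤ v := by have := (abs_lt.1 h12).1; omega
    have h2 : v ≤ 11 := by have := (abs_lt.1 h12).2; omega
    rcases hs with rfl | rfl <;> interval_cases v <;> (try (exfalso; norm_num [Int.odd_iff] at hv; done)) <;> norm_num [Int.odd_iff]

/-- Budget on 12 bits: `Σ (u − 4s)² = 2¹⁷(1 − Φ)` (`W_g = 16u`). -/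
theorem tw12_budget (f g : (Fin (6 + 6) → Bool) → Bool) (u : (Fin (6 + 6) → Bool) → ℤ)
    (hu : ∀ x, W (fun y => signOf (g y)) x = (2 : ℝ) ^ 4 * (u x : ℝ)) :
    ((∑ x, (u x - 4 * sZ (f x)) ^ 2 : ℤ) : ℝ) = (2 : ℝ) ^ 17 * (1 - forrelation f g) := by
  have h := zms_budget 2 f g u (fun x => (hu x).trans (by norm_num))
  norm_num at h ⊢
  try exact h
  try linarith

/-- Pairing on 12 bits: `Σ_y (−1)^{g(y)} (u − 4(−1)^f)^(y) = 2²⁰(1 − Φ)`. -/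
theorem tw12_pairing (f g : (Fin (6 + 6) → Bool) → Bool) (u : (Fin (6 + 6) → Bool) → ℤ)
    (hu : ∀ x, W (fun y => signOf (g y)) x = (2 : ℝ) ^ 4 * (u x : ℝ)) :
    ∑ y, signOf (g y) * W (fun x => (u x : ℝ) - 4 * signOf (f x)) y = (2 : ℝ) ^ 20 * (1 - forrelation f g) := by
  have h := zms_pairing 2 f g u (fun x => (hu x).trans (by norm_num))
  norm_num at h ⊢
  try exact h
  try linarith

/-- **A type-O cubic on 12 bits never reaches `Φ = 15/16`.**  For cubic `f, g : 𝔽₂¹² → 𝔽₂` with `W_g = 16u`, every `u(x)` odd and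
`Φ(f,g) ≥ 15/16`: contradiction.  Finite-slice statement; NOT summit progress. [this work] -/
theorem tw12_typeO_false (f g : (Fin (6 + 6) → Bool) → Bool) (hf : IsDegLeFun 3 f) (hg : IsDegLeFun 3 g)
    (u : (Fin (6 + 6) → Bool) → ℤ) (hu : ∀ x, W (fun y => signOf (g y)) x = (2 : ℝ) ^ 4 * (u x : ℝ))
    (hodd : ∀ x, Odd (u x)) (hΦ : (15 / 16 : ℝ) ≤ forrelation f g) : False := by
  classical
  have _hf := hf
  have hu' : ∀ x, W (fun y => signOf (g y)) x = (2 : ℝ) ^ (2 * 2) * (u x : ℝ) := fun x => (hu x).trans (by norm_num)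
  have hd1 : IsDegLeFun 1 (fun x => decide (Odd (u x / 2))) := z2_digitOne 2 g u hg hu' hodd
  have hd2 : IsDegLeFun 3 (fun x => decide (Odd (u x / 2 / 2))) := z2_digitTwo 2 g u hg hu' hodd
  -- case A (all `u ≡ ±3 (mod 8)`) is empty
  have hnoA : ¬ (∀ x, ¬ (Odd (u x / 2) ↔ Odd (u x / 2 / 2))) := by
    intro h
    refine TypeOTwelve.no_caseA g u hg hu fun x => ?_
    have h0 := Int.odd_iff.1 (hodd x)
    have hx := h x
    rw [Int.odd_iff, Int.odd_iff] at hx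
    omega
  set E := univ.filter (fun x : Fin (6 + 6) → Bool => (Odd (u x / 2) ↔ Odd (u x / 2 / 2))) with hEdef
  have hmemE : ∀ x, x ∈ E ↔ (Odd (u x / 2) ↔ Odd (u x / 2 / 2)) := fun x => by simp [hEdef]
  have hdegE : IsDegLeFun (2 + 1) (fun x => (decide (Odd (u x / 2)) ^^ decide (Odd (u x / 2 / 2))) ^^ true) :=
    tb_isDegLeFun_xor_const (bb_isDegLeFun_bxor (hd1.mono (by norm_num)) hd2) true
  have hsetE : (univ.filter fun x : Fin (6 + 6) → Bool =>
      ((decide (Odd (u x / 2)) ^^ decide (Odd (u x / 2 / 2))) ^^ true) = true) = E := by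
    rw [hEdef]
    apply filter_congr
    intro x _
    by_cases h1 : Odd (u x / 2) <;> by_cases h2 : Odd (u x / 2 / 2) <;> simp [h1, h2]
  have hne : ∃ x, ((decide (Odd (u x / 2)) ^^ decide (Odd (u x / 2 / 2))) ^^ true) = true := by
    by_contra hnone
    push Not at hnone
    refine hnoA fun x => ?_
    have hx := hnone x
    by_cases h1 : Odd (u x / 2) <;> by_cases h2 : Odd (u x / 2 / 2) <;> simp [h1, h2] at hx ⊢
  have hrm := bb_rmWeight_holds (6 + 6) 3 _ hdegE hne
  rw [hsetE] at hrm
  have hEge : 512 ≤ #E := by norm_num at hrm; omega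
  -- budget and the pointwise cost
  have hbud := tw12_budget f g u hu
  have hT : (∑ x, (u x - 4 * sZ (f x)) ^ 2 : ℤ) ≤ 8192 := by
    have h' : ((∑ x, (u x - 4 * sZ (f x)) ^ 2 : ℤ) : ℝ) ≤ 8192 := by rw [hbud]; nlinarith
    exact_mod_cast h'
  have hsumE : (∑ x, (if (Odd (u x / 2) ↔ Odd (u x / 2 / 2)) then 1 else 0 : ℤ)) = #E := by rw [sum_boole]
  have hnonneg : ∀ x, 0 ≤ (u x - 4 * sZ (f x)) ^ 2 - (1 + 8 * (if (Odd (u x / 2) ↔ Odd (u x / 2 / 2)) then 1 else 0 : ℤ)) :=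
    fun x => by have := tw12_pt (u x) (sZ (f x)) (hodd x) (tp_sZ_cases (f x)); linarith
  have hsum0 : ∑ x, ((u x - 4 * sZ (f x)) ^ 2 - (1 + 8 * (if (Odd (u x / 2) ↔ Odd (u x / 2 / 2)) then 1 else 0 : ℤ))) = 0 := by
    refine le_antisymm ?_ (sum_nonneg fun x _ => hnonneg x)
    rw [sum_sub_distrib, sum_add_distrib, ← mul_sum, hsumE, sum_const, card_univ, Fintype.card_fun, Fintype.card_bool,
      Fintype.card_fin]
    have : (512 : ℤ) ≤ #E := by exact_mod_cast hEge
    norm_num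
    linarith
  have hpt : ∀ x, (u x - 4 * sZ (f x)) ^ 2 = 1 + 8 * (if (Odd (u x / 2) ↔ Odd (u x / 2 / 2)) then 1 else 0 : ℤ) :=
    fun x => by have := (sum_eq_zero_iff_of_nonneg fun y _ => hnonneg y).1 hsum0 x (mem_univ x); linarith
  have hEcard : #E = 512 := by
    have hT' : (4096 : ℤ) + 8 * #E ≤ 8192 := by
      have e : (∑ x, (u x - 4 * sZ (f x)) ^ 2 : ℤ) = 4096 + 8 * #E := by
        rw [sum_congr rfl fun x _ => hpt x, sum_add_distrib, ← mul_sum, hsumE, sum_const, card_univ, Fintype.card_fun,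
          Fintype.card_bool, Fintype.card_fin]
        norm_num
      rw [← e]; exact hT
    have hle : #E ≤ 512 := by
      have : (#E : ℤ) ≤ 512 := by linarith
      exact_mod_cast this
    omega
  have hΦeq : forrelation f g = 15 / 16 := by
    have e : (∑ x, (u x - 4 * sZ (f x)) ^ 2 : ℤ) = 8192 := by
      rw [sum_congr rfl fun x _ => hpt x, sum_add_distrib, ← mul_sum, hsumE, sum_const, card_univ, Fintype.card_fun,
        Fintype.card_bool, Fintype.card_fin, hEcard]
      norm_num
    have h : ((∑ x, (u x - 4 * sZ (f x)) ^ 2 : ℤ) : ℝ) = 8192 := by exact_mod_cast e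
    rw [hbud] at h
    linarith
  -- the residual
  have hτ1 : ∀ x, x ∉ E → u x - 4 * sZ (f x) = sZ (decide (Odd (u x / 2))) := by
    intro x hx
    have h := hpt x
    rw [if_neg (fun h' => hx ((hmemE x).2 h'))] at h
    have h1 : (u x - 4 * sZ (f x)) * (u x - 4 * sZ (f x)) = 1 := by rw [← pow_two]; linarith
    exact sp_tau_one (mul_self_eq_one_iff.1 h1)
  have hτ3 : ∀ x, x ∈ E → u x - 4 * sZ (f x) = -3 * sZ (decide (Odd (u x / 2))) := by
    intro x hx
    have h := hpt x
    rw [if_pos ((hmemE x).1 hx)] at h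
    exact sp_tau_three (by linarith)
  -- `E` is a 9-flat
  have hmwE := mw_flat_of_minweight 2 _ hdegE (by rw [hsetE, hEcard]; norm_num)
  rw [hsetE] at hmwE
  obtain ⟨h0E, haddE, hcardVE, hcosetE⟩ := hmwE
  set VE := univ.filter (fun a : Fin (6 + 6) → Bool => ∀ x,
    ((decide (Odd (u (bxor x a) / 2)) ^^ decide (Odd (u (bxor x a) / 2 / 2))) ^^ true) =
      ((decide (Odd (u x / 2)) ^^ decide (Odd (u x / 2 / 2))) ^^ true)) with hVE
  rw [hEcard] at hcardVE
  have hEpos : 0 < #E := by rw [hEcard]; norm_num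
  obtain ⟨xE, hxE⟩ : E.Nonempty := card_pos.1 hEpos
  have hSE : E = VE.image (bxor xE) := hcosetE xE (by
    have h := (hmemE xE).1 hxE
    by_cases h1 : Odd (u xE / 2)
    · have h2 : Odd (u xE / 2 / 2) := h.1 h1
      simp [h1, h2]
    · have h2 : ¬ Odd (u xE / 2 / 2) := fun h' => h1 (h.2 h')
      simp [h1, h2])
  -- `d₁` is affine: every translation is a period up to sign of `(−1)^{d₁}`
  have hDconst : ∀ a x : Fin (6 + 6) → Bool,
      decide (Odd (u (bxor x a) / 2)) = (decide (Odd (u x / 2)) ^^ (decide (Odd (u zeroVec / 2)) ^^ decide (Odd (u a / 2)))) := by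
    intro a x
    have hc := tc_const_of_deg_zero (stub_derivDegree (6 + 6) 0 (fun x => decide (Odd (u x / 2))) a hd1) x zeroVec
    simp only [zeroVec_bxor] at hc
    revert hc
    cases decide (Odd (u (bxor x a) / 2)) <;> cases decide (Odd (u x / 2)) <;> cases decide (Odd (u zeroVec / 2)) <;>
      cases decide (Odd (u a / 2)) <;> decide
  set A₁ : (Fin (6 + 6) → Bool) → ℝ := fun x => signOf (decide (Odd (u x / 2))) with hA₁
  set A₂ : (Fin (6 + 6) → Bool) → ℝ := fun x => if x ∈ E then signOf (decide (Odd (u x / 2))) else 0 with hA₂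
  have h1b := fp_l1_sq_mul_le A₁ univ univ (fun x _ => by simp only [A₁]; unfold signOf; split_ifs <;> simp)
    (fun x hx => absurd (mem_univ x) hx) (mem_univ _) (fun a _ b _ => mem_univ _) (fun a _ => by
      refine ⟨signOf (decide (Odd (u zeroVec / 2)) ^^ decide (Odd (u a / 2))), ?_, fun x => ?_⟩
      · unfold signOf; split_ifs <;> simp
      · simp only [A₁]; rw [hDconst a x, signOf_xor]; ring)
  rw [card_univ, Fintype.card_fun, Fintype.card_bool, Fintype.card_fin] at h1b
  have hX : ∑ y, |W A₁ y| ≤ 4096 := by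
    have hnn : 0 ≤ ∑ y, |W A₁ y| := sum_nonneg fun y _ => abs_nonneg _
    push_cast at h1b
    nlinarith
  have h2b := fp_l1_sq_mul_le A₂ E VE (fun x hx => by
      simp only [A₂, if_pos hx]; unfold signOf; split_ifs <;> simp) (fun x hx => by simp only [A₂, if_neg hx]) h0E haddE
    (fun a ha => by
      refine ⟨signOf (decide (Odd (u zeroVec / 2)) ^^ decide (Odd (u a / 2))), ?_, fun x => ?_⟩
      · unfold signOf; split_ifs <;> simp
      · by_cases hx : x ∈ E
        · have hxa : bxor x a ∈ E := fl1_coset_vadd haddE hSE hx ha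
          simp only [A₂, if_pos hx, if_pos hxa]; rw [hDconst a x, signOf_xor]; ring
        · have hxa : bxor x a ∉ E := fl1_coset_out' haddE hSE hx ha
          simp only [A₂, if_neg hx, if_neg hxa, mul_zero])
  rw [hcardVE, hEcard] at h2b
  have hY : ∑ y, |W A₂ y| ≤ 4096 := by
    have hnn : 0 ≤ ∑ y, |W A₂ y| := sum_nonneg fun y _ => abs_nonneg _
    push_cast at h2b
    nlinarith
  -- decomposition and pairing
  have hdecomp : (fun x => (u x : ℝ) - 4 * signOf (f x)) = fun x => A₁ x + (-4) * A₂ x := by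
    funext x
    have e : (u x : ℝ) - 4 * signOf (f x) = (((u x - 4 * sZ (f x) : ℤ)) : ℝ) := by push_cast; rw [tp_sZ_cast]
    rw [e]
    by_cases hx : x ∈ E
    · simp only [A₁, A₂, if_pos hx]; rw [hτ3 x hx]; push_cast; rw [tp_sZ_cast]; ring
    · simp only [A₁, A₂, if_neg hx]; rw [hτ1 x hx, tp_sZ_cast]; ring
  have hpair := tw12_pairing f g u hu
  rw [hΦeq, hdecomp] at hpair
  have e2 : ∀ y, signOf (g y) * W (fun x => A₁ x + (-4) * A₂ x) y =
      signOf (g y) * W A₁ y + (-4) * (signOf (g y) * W A₂ y) := fun y => by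
    rw [sp_W_add, fl1_W_smul]; ring
  rw [sum_congr rfl fun y _ => e2 y, sum_add_distrib, ← mul_sum] at hpair
  have hP1 : ∑ y, signOf (g y) * W A₁ y ≤ ∑ y, |W A₁ y| := fl1_pairing_le_l1 g (W A₁)
  have hP2 : |∑ y, signOf (g y) * W A₂ y| ≤ ∑ y, |W A₂ y| :=
    (abs_sum_le_sum_abs _ _).trans (sum_le_sum fun y _ => by
      rw [abs_mul]; unfold signOf; split_ifs <;> norm_num)
  have hP2' := (abs_le.1 hP2).1
  have h20 : (2 : ℝ) ^ 20 * (1 - 15 / 16) = 65536 := by norm_num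
  rw [h20] at hpair
  linarith

end Summit.QuantumAdvantage.QuantumAdvantage.Theorems.CubicForrelation.NearExactIsExact

end
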